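import Mathlib
import HarnessLib

/-!
# Route `KLProgramme` — crux K3 `KLRegimeTwoPointLimit` (stmt-HubbardSuperconductivity-19937), support:
# the scale sums of the two-shell bound (DECOMP App. E Lemma E.1/E.3, Corollary; E2(a) freezing and
# E2(b)/E.3 no flow at the caustic)

Cell `gate-hubbard-kl`, seat p1b; paper note `HOME/prover-p1b/E1-NOTE.md` §2 Corollary. With depth
indices `n = -j ≥ 0` (single-scale propagator at scale `γ^{-n}`) and transfer depth `τ = -t`
(`|q|_𝕋 = γ^{-τ}`), Lemma E.1 bounds the scale-`(n, n')` particle–particle bubble at transfer `q` by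
`C·min(γ^{-(n-n')}, γ^{-(n-τ)})` (`n' ≤ n`), and Lemma E.3 bounds the particle–hole bubble ON the
caustic by `C·γ^{n'/2 - n}`. This file is the elementary geometric-series algebra turning these into
the statements Lemma E.4 consumes:

* `klss_sum_min_le` — BELOW the transfer scale (`τ ≤ n`):
  `Σ_{n' ≤ n} min(γ^{-(n-n')}, γ^{-(n-τ)}) ≤ ((n - τ) + 1 + 1/(γ-1))·γ^{-(n-τ)}`: the increments are
  summable in `n` with total `O(1)` (`klss_sum_weighted_geometric_le`) — the coupling at transfer `q`
  FREEZES;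
* `klss_sum_above_le` — ABOVE the transfer scale (`n < τ`): `Σ_{n' ≤ n} γ^{-(n-n')} ≤ γ/(γ-1)`;
* `klss_sum_caustic_le` — ON the caustic: `Σ_{n' ≤ n} γ^{n'/2}·γ^{-n} ≤ (√γ/(√γ-1))·γ^{-n/2}`, summable
  in `n`: no logarithmic particle–hole flow at `2k_F`.

Pure Mathlib (finite geometric sums, `tsum_coe_mul_geometric_of_norm_lt_one`); `γ > 1` arbitrary
(BGM: `γ = 4`).
-/

noncomputable section

-- the tree's namespace `Summit.<Summit>.<Problem>.Theorems` repeats the summit name by design (D-0017)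
set_option linter.dupNamespace false

open Real Finset
open scoped BigOperators

namespace Summit.HubbardSuperconductivity.HubbardSuperconductivity.Theorems

/-- Geometric partial sums of `γ⁻¹`: `Σ_{k < n} (γ⁻¹)^k ≤ γ/(γ - 1)` for `γ > 1`. -/
theorem klss_geom_sum_inv_le {γ : ℝ} (hγ : 1 < γ) (n : ℕ) :
    ∑ k ∈ range n, (γ⁻¹) ^ k ≤ γ / (γ - 1) := by
  have hγ0 : 0 < γ := by linarith
  have hx0 : 0 ≤ γ⁻¹ := by positivity
  have hx1 : γ⁻¹ < 1 := inv_lt_one_of_one_lt₀ hγ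
  have h := geom_sum_Ico_le_of_lt_one hx0 hx1 (m := 0) (n := n)
  rw [range_eq_Ico]
  refine h.trans (le_of_eq ?_)
  rw [pow_zero]
  field_simp

/-- **Below the transfer scale.** For `γ > 1` and depths `τ ≤ n`:
`Σ_{n'=0}^{n} min((γ⁻¹)^{n-n'}, (γ⁻¹)^{n-τ}) ≤ ((n - τ) + 1 + 1/(γ - 1))·(γ⁻¹)^{n-τ}`
(scales shallower than the transfer, `n' < τ`, contribute `γ⁻¹`-geometrically, the `n - τ + 1` deeper ones,
`τ ≤ n' ≤ n`, the flat value). -/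
theorem klss_sum_min_le {γ : ℝ} (hγ : 1 < γ) {τ n : ℕ} (hτn : τ ≤ n) :
    ∑ n' ∈ range (n + 1), min ((γ⁻¹) ^ (n - n')) ((γ⁻¹) ^ (n - τ)) ≤
      (((n - τ : ℕ) : ℝ) + 1 + 1 / (γ - 1)) * (γ⁻¹) ^ (n - τ) := by
  have hγ0 : 0 < γ := by linarith
  set x : ℝ := γ⁻¹ with hx
  have hx0 : 0 ≤ x := by positivity
  have hx1 : x < 1 := inv_lt_one_of_one_lt₀ hγ
  have hxpos : 0 < x := by positivity
  -- split the range at `τ`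
  rw [range_eq_Ico]
  rw [← sum_Ico_consecutive _ (Nat.zero_le τ) (by omega : τ ≤ n + 1)]
  -- deep part: `n' < τ`
  have hdeep : ∑ n' ∈ Ico 0 τ, min (x ^ (n - n')) (x ^ (n - τ)) ≤ x ^ (n - τ) * (1 / (γ - 1)) := by
    calc ∑ n' ∈ Ico 0 τ, min (x ^ (n - n')) (x ^ (n - τ))
        ≤ ∑ n' ∈ Ico 0 τ, x ^ (n - τ) * x ^ (τ - n') := by
          refine sum_le_sum (fun n' hn' => ?_)
          rw [mem_Ico] at hn'
          have e : n - n' = (n - τ) + (τ - n') := by omega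
          calc min (x ^ (n - n')) (x ^ (n - τ)) ≤ x ^ (n - n') := min_le_left _ _
            _ = x ^ (n - τ) * x ^ (τ - n') := by rw [e, pow_add]
      _ = x ^ (n - τ) * ∑ n' ∈ Ico 0 τ, x ^ (τ - n') := by rw [mul_sum]
      _ ≤ x ^ (n - τ) * (1 / (γ - 1)) := by
          refine mul_le_mul_of_nonneg_left ?_ (by positivity)
          -- `Σ_{n' < τ} x^{τ-n'} = x · Σ_{j < τ} x^j ≤ x · γ/(γ-1) = 1/(γ-1)`
          have hrefl : ∑ n' ∈ Ico 0 τ, x ^ (τ - n') = ∑ j ∈ range τ, x ^ (j + 1) := by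
            rw [← range_eq_Ico, ← sum_range_reflect (fun j => x ^ (j + 1)) τ]
            refine sum_congr rfl (fun j hj => ?_)
            rw [mem_range] at hj
            congr 1; omega
          rw [hrefl]
          have h2 : ∑ j ∈ range τ, x ^ (j + 1) = x * ∑ j ∈ range τ, x ^ j := by
            rw [mul_sum]; refine sum_congr rfl (fun j _ => by ring)
          rw [h2]
          have h3 := klss_geom_sum_inv_le hγ τ
          calc x * ∑ j ∈ range τ, x ^ j ≤ x * (γ / (γ - 1)) := mul_le_mul_of_nonneg_left h3 hx0
            _ = 1 / (γ - 1) := by rw [hx]; field_simp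
  -- shallow part: `τ ≤ n' ≤ n`
  have hshallow : ∑ n' ∈ Ico τ (n + 1), min (x ^ (n - n')) (x ^ (n - τ)) ≤
      (((n - τ : ℕ) : ℝ) + 1) * x ^ (n - τ) := by
    calc ∑ n' ∈ Ico τ (n + 1), min (x ^ (n - n')) (x ^ (n - τ))
        ≤ ∑ _n' ∈ Ico τ (n + 1), x ^ (n - τ) := sum_le_sum (fun n' _ => min_le_right _ _)
      _ = ((Ico τ (n + 1)).card : ℝ) * x ^ (n - τ) := by rw [sum_const, nsmul_eq_mul]
      _ = (((n - τ : ℕ) : ℝ) + 1) * x ^ (n - τ) := by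
          rw [Nat.card_Ico]
          congr 1
          have : n + 1 - τ = (n - τ) + 1 := by omega
          rw [this]; push_cast; ring
  calc _ ≤ x ^ (n - τ) * (1 / (γ - 1)) + (((n - τ : ℕ) : ℝ) + 1) * x ^ (n - τ) := add_le_add hdeep hshallow
    _ = (((n - τ : ℕ) : ℝ) + 1 + 1 / (γ - 1)) * x ^ (n - τ) := by ring

/-- **Above the transfer scale.** For `γ > 1` and every `n`:
`Σ_{n'=0}^{n} (γ⁻¹)^{n-n'} ≤ γ/(γ - 1)` (no freezing yet, but `O(1)` per scale). -/
theorem klss_sum_above_le {γ : ℝ} (hγ : 1 < γ) (n : ℕ) :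
    ∑ n' ∈ range (n + 1), (γ⁻¹) ^ (n - n') ≤ γ / (γ - 1) := by
  have hrefl : ∑ n' ∈ range (n + 1), (γ⁻¹) ^ (n - n') = ∑ j ∈ range (n + 1), (γ⁻¹) ^ j := by
    rw [← sum_range_reflect (fun j => (γ⁻¹) ^ j) (n + 1)]
    refine sum_congr rfl (fun j _ => ?_)
    have e : n + 1 - 1 - j = n - j := by omega
    simp only [e]
  rw [hrefl]
  exact klss_geom_sum_inv_le hγ (n + 1)

/-- **Summability of the frozen increments.** For `γ > 1`, `c ≥ 0` and every `M`:
`Σ_{m=0}^{M} (m + c)(γ⁻¹)^m ≤ γ/(γ-1)² + c·γ/(γ-1)` (the total of the per-scale bounds of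
`klss_sum_min_le` over all scales below the transfer, `m = n - τ`, `c = 1 + 1/(γ-1)`). -/
theorem klss_sum_weighted_geometric_le {γ c : ℝ} (hγ : 1 < γ) (hc : 0 ≤ c) (M : ℕ) :
    ∑ m ∈ range (M + 1), ((m : ℝ) + c) * (γ⁻¹) ^ m ≤ γ / (γ - 1) ^ 2 + c * (γ / (γ - 1)) := by
  have hγ0 : 0 < γ := by linarith
  set x : ℝ := γ⁻¹ with hx
  have hx0 : 0 ≤ x := by positivity
  have hx1 : x < 1 := inv_lt_one_of_one_lt₀ hγ
  have hnorm : ‖x‖ < 1 := by rw [Real.norm_eq_abs, abs_of_nonneg hx0]; exact hx1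
  -- the two infinite sums
  have hs1 : HasSum (fun m : ℕ => (m : ℝ) * x ^ m) (x / (1 - x) ^ 2) :=
    hasSum_coe_mul_geometric_of_norm_lt_one hnorm
  have hs2 : HasSum (fun m : ℕ => x ^ m) (1 - x)⁻¹ := hasSum_geometric_of_lt_one hx0 hx1
  have hsum : HasSum (fun m : ℕ => ((m : ℝ) + c) * x ^ m) (x / (1 - x) ^ 2 + c * (1 - x)⁻¹) := by
    have := hs1.add (hs2.mul_left c)
    convert this using 1
    funext m; ring
  have hle := sum_le_hasSum (range (M + 1)) (fun m _ => by positivity) hsum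
  refine hle.trans (le_of_eq ?_)
  rw [hx]
  have hγ1 : γ - 1 ≠ 0 := by linarith
  have e1 : (1 - γ⁻¹) = (γ - 1) / γ := by field_simp
  rw [e1]
  field_simp

/-- **On the caustic.** For `γ > 1` and every `n`:
`Σ_{n'=0}^{n} (√γ)^{n'}·γ^{-n} ≤ (√γ/(√γ - 1))·(√γ)^{-n}` — the particle–hole bubble at transfer `2k_F`
is `O(γ^{-n/2})` at depth `n`, summable over scales (`klss_geom_sum_inv_le` with `√γ`): no
logarithmic flow at the caustic in `d = 2`. -/
theorem klss_sum_caustic_le {γ : ℝ} (hγ : 1 < γ) (n : ℕ) :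
    ∑ n' ∈ range (n + 1), Real.sqrt γ ^ n' * (γ⁻¹) ^ n ≤
      Real.sqrt γ / (Real.sqrt γ - 1) * (Real.sqrt γ)⁻¹ ^ n := by
  have hγ0 : 0 < γ := by linarith
  set s := Real.sqrt γ with hs
  have hs1 : 1 < s := by
    rw [hs]; exact (Real.lt_sqrt (by norm_num)).2 (by nlinarith)
  have hs0 : 0 < s := by linarith
  have hss : s ^ 2 = γ := Real.sq_sqrt hγ0.le
  rw [← sum_mul, geom_sum_eq (ne_of_gt hs1)]
  -- `(s^{n+1} - 1)/(s - 1) · γ^{-n} ≤ s^{n+1}/(s-1) · s^{-2n} = (s/(s-1)) s^{-n}`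
  have hγn : (γ⁻¹) ^ n = (s⁻¹) ^ n * (s⁻¹) ^ n := by
    rw [← mul_pow, ← mul_inv, ← sq, hss]
  rw [hγn]
  have h1 : (s ^ (n + 1) - 1) / (s - 1) ≤ s ^ (n + 1) / (s - 1) :=
    div_le_div_of_nonneg_right (by linarith) (by linarith)
  have hsn : 0 ≤ (s⁻¹) ^ n := by positivity
  calc (s ^ (n + 1) - 1) / (s - 1) * ((s⁻¹) ^ n * (s⁻¹) ^ n)
      ≤ s ^ (n + 1) / (s - 1) * ((s⁻¹) ^ n * (s⁻¹) ^ n) :=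
        mul_le_mul_of_nonneg_right h1 (by positivity)
    _ = s / (s - 1) * (s⁻¹) ^ n := by
        have hsn' : s ^ n * (s⁻¹) ^ n = 1 := by rw [← mul_pow, mul_inv_cancel₀ hs0.ne', one_pow]
        have e2 : s ^ (n + 1) * (s⁻¹) ^ n = s := by rw [pow_succ', mul_assoc, hsn', mul_one]
        calc s ^ (n + 1) / (s - 1) * ((s⁻¹) ^ n * (s⁻¹) ^ n)
            = (s ^ (n + 1) * (s⁻¹) ^ n) / (s - 1) * (s⁻¹) ^ n := by ring
          _ = s / (s - 1) * (s⁻¹) ^ n := by rw [e2]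

end Summit.HubbardSuperconductivity.HubbardSuperconductivity.Theorems

end
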